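import Literature.NumberTheory.Automorphic.Liu2021.Thm418CombinedReading
import Literature.NumberTheory.Automorphic.PicardCMPrerequisites
import Mathlib.LinearAlgebra.Eigenspace.Basic
import Mathlib.LinearAlgebra.Dimension.Finrank
import HarnessLib

/-!
# [Liu 2021] proof of Theorem 4.18 — the map (4.3) «by pulling back `α`», EXACTLY AS PRINTED

Y. Liu, *Fourier–Jacobi cycles and arithmetic relative trace formula*, Camb. J. Math. **9** (2021) 1–147 = arXiv:2102.11518
[Liu2021]; PRIMARY SOURCE READ: the author's TeX `FJcycle.tex` (md5 `6db49a74122d2cb0f224fa1b39488a0c`; held at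
`run/shared/lean/pub/pub-hodgecm/pub-hodgecm-cf-kudla-howe-rallis-g4/lit/Liu21-arxiv-src/FJcycle.tex`), every `l. NNNN` below
is a line of that file.  Companion of `Thm418AsPrinted` (p277833, the STATEMENT of Thm. 4.18 exactly as printed) — same
discipline, same carriers: this file types the one object of the PROOF of Thm. 4.18 that the cells' closing chain consumes,
the map (4.3) (TeX label `eq:cm_albanese`), together with the sentences the proof prints about it.  Lemma 2.4 (1)
(`H¹_{B,τ}(Alb_X, ℚ) ≃ H¹_{B,τ}(X, ℚ)`, l. 1210–1213), which the consumer's class identification uses, is NOT re-typed as a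
carrier record: the tree has it on REAL objects — `Literature.AlgebraicGeometry.Motives.Jacobian.injective_bettiCohomology_map_abelJacobi_one_of_dim`,
`….isIso_bettiCohomology_map_abelJacobi_iff_finrank_le_of_dim`, `….bijective_baseChange_bettiCohomology_map_abelJacobi_of_finrank_le_of_dim`
(`Motives/AlbaneseRationalCohomology.lean`, [cite: Liu2021, Lemma 2.4 (1)] there), with the base change of `Alb_{X_K}` on components in
`Liu2021/AlbaneseBaseChange.lean` (p302423) — consumers cite those BY NAME (pub-hodgecm2 lead gen 8, INBOX l. 5715 (1)(b)).

WHY.  The tree's bridge `Thm418Data.resW_mem_span_of_fixed_of_thm418AsPrinted` / `…block_resW_mem_span_of_thm418AsPrinted`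
(`Thm418CombinedReading.lean`, p301605/p302123) re-bases the stage-1 package's combined reading r8 (`Thm418C`) on the as-printed
cite `Thm418AsPrinted D` PLUS three consumer-side binders `J` / `hJ` / `hJinj` standing for «the proof's map (4.3), equivariant,
injective» (HONEST FINDING there: the printed STATEMENT gives an abstract isomorphism; the reading uses the PROOF's map).  This
file is the statement-exact record those three binders cite BY NAME: `Map43Data.J`, `Map43Data.hJ_of_asPrinted`,
`Map43Data.injective_J_of_asPrinted` (HM-EQUALITY Δ2 residual «(4.3)-carrier (M2)»; pub-hodgecm2 lead INBOX l. 5084; LENS-1 test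
of record, b01-idea-1 INBOX l. 5272 / IDEA-1z §5: a CARRIER with the LITERAL pull-back formula of (4.3) on pure tensors +
equivariance + injectivity).

## The printed text (verbatim; TeX macros resolved as in `Thm418AsPrinted`)

**Rem. 4.17** (l. 2226–2228): «It follows from Proposition 4.6 (1) that for every object `D_μ = (A_μ, i_μ, λ_μ, r_μ) ∈ 𝒜(μ)`, the
canonical map `Hom_E(A_∞, A_μ)_ℚ → Ω(μ)` is an isomorphism.»

**Proof of Theorem 4.18, first part** (l. 2247–2253): «Take an arbitrary object `D_μ = (A_μ, i_μ, λ_μ, r_μ) ∈ 𝒜(μ)` and identify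
`Ω(μ)` with `Hom_E(A_∞, A_μ)_ℚ` by Remark 4.17.  Take an embedding `τ' : E → ℂ` in `Φ_μ`. It is clear that the maximal subspace
of the complex vector space `H¹_{B,τ'}(A_μ, ℂ)` over which `M_μ` acts via the inclusion `M_μ ↪ ℂ` has dimension `1`. We choose a
basis `α` of this subspace. Then we obtain a map `Ω(μ) → H¹_{B,τ'}(A_∞, ℂ)` by pulling back `α`, which is
`ℂ[𝔾(𝔸_F^∞)]`-linear. It canonically extends to a map
    (4.3)   `Ω(μ) ⊗_{M_μ} ℂ → H¹_{B,τ'}(A_∞, ℂ)`.»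
**second part** (l. 2254–2270): «To compute this map, we choose a rational prime `ℓ` and an isomorphism `ι_ℓ : ℂ ≅ ℚ_ℓ^{ac}`. By the
comparison theorem, (4.3) induces the following map `Ω(μ) ⊗_{M_μ,ι_ℓ} ℚ_ℓ^{ac} → H¹_{ét}(A_∞ ⊗_{E,τ'} ℂ, ℚ_ℓ^{ac})` by pulling back
`α` […]. By Faltings' isogeny theorem [Fal83], we have a canonical isomorphism `Ω(μ) ⊗_{M_μ,ι_ℓ} ℚ_ℓ^{ac} ≃
Hom_{ℚ_ℓ^{ac}[Gal(ℂ/τ'(E))]}(ℚ_ℓ^{ac} · α, H¹_{ét}(A_μ ⊗_{E,τ'} ℂ, ℚ_ℓ^{ac}))`. […] When `n ≥ 3` (resp. `n = 2`), by Proposition 4.13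
(resp. …) and Theorem 4.15 (resp. …), we have an isomorphism `Hom_{…}(ℚ_ℓ^{ac} · α, H¹_{ét}(…)) ≃ ⊕_ε ⊕_χ ω(μ, ε, χ) ⊗_{ℂ,ι_ℓ}
ℚ_ℓ^{ac}` of `ℚ_ℓ^{ac}[𝔾(𝔸_F^∞)]`-modules induced by pulling back `α`, where the direct sum is taken over all `ε, χ` such that `ε`
is `μ`-admissible. Thus, we obtain an isomorphism as in the theorem, which depends only on `α`, not on `ℓ`, `ι_ℓ`, and `τ'`.
The additional statement (1) follows from the above discussion as well.»

## The typing (⟨CARRIER⟩ = posited datum standing for a printed object Lean cannot construct — see `Thm418AsPrinted`)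

Over a datum `D : Thm418Data F E` (its `μ`, `M_μ = fieldOfValues E D.μ`, `Φ_μ = D.cmType`, `𝔾(𝔸_F^∞) = D.G`, `Ω(μ) = D.Ω` with
`D.rhoΩ`, objects `D.Obj`, `Hom_E(A_K, A_μ)_ℚ = D.HomK K D_μ` with `D.res`), `Thm418Data.Map43Data D` records, in the proof's order:
* «Take an arbitrary object `D_μ ∈ 𝒜(μ)`» — `Dμ : D.Obj`;
* «Take an embedding `τ' : E → ℂ` in `Φ_μ`» — `τ'`, `τ'_mem : τ' ∈ Φ_μ`;
* ⟨CARRIER⟩ `HB` with `ρB : Representation ℂ D.G HB` = «the complex vector space» `H¹_{B,τ'}(A_∞, ℂ) := colim_K H¹_{B,τ'}(A_K, ℂ)`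
  with its `𝔾(𝔸_F^∞)`-action through the Hecke action on `A_∞` (§4.2 l. 2070–2081; = `Prop413Data.HB τ'` / `rhoB τ'` for a
  consumer citing Prop. 4.13 over the same `𝕍` — their bookkeeping).  Its `M_μ`-module structure is restriction of scalars along
  `M_μ ⊆ ℂ` (Mathlib's inherited action of an intermediate field of `ℂ` on a `ℂ`-module, `m • x = (m : ℂ) • x`; nothing posited);
* ⟨CARRIER⟩ `HBμ` = «the complex vector space `H¹_{B,τ'}(A_μ, ℂ)`» with ⟨CARRIER⟩ `iB : M_μ →+* End_ℂ(H¹_{B,τ'}(A_μ, ℂ))` = the action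
  «over which `M_μ` acts» induced by the CM structure `i_μ : M_μ → End_E(A_μ)_ℚ` (Def. 4.5 (2)) and functoriality of Betti `H¹`;
* `eigenline` = «the maximal subspace … over which `M_μ` acts via the inclusion `M_μ ↪ ℂ`» = `⋂_m ker(iB m − m)` (the tree's
  `Literature.NumberTheory.Automorphic.PicardCM.eigenline` at the inclusion `M_μ ⊆ ℂ`; an abbreviation);
* «We choose a basis `α` of this subspace» — `α : HBμ`, `α_mem : α ∈ eigenline`, `α_ne : α ≠ 0` (the CHOICE; that the subspace
  «has dimension `1`» is the proof's ASSERTION, clause (i) of the predicate);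
* ⟨CARRIER⟩ `pull : Ω(μ) → (H¹_{B,τ'}(A_μ, ℂ) →ₗ[ℂ] H¹_{B,τ'}(A_∞, ℂ))`, `f ↦ f^*` — pull-back of Betti classes along
  `f ∈ Hom_E(A_∞, A_μ)_ℚ = Ω(μ)` (the identification of Rem. 4.17 at `D_μ`, l. 2248), with the two functoriality laws ⟨CARRIER LAW⟩
  `pull_add` (`(f + f')^* = f^* + f'^*`) and `pull_smul` (`(i_μ(m) ∘ f)^* = f^* ∘ i_μ(m)^*`, «`M_μ` acts via `i_μ`», Def. 4.16 l. 2219)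
  — exactly what makes «pulling back `α`» an `M_μ`-linear map, hence what lets (4.3) «canonically extend»;
* DEFINED `pb : Ω(μ) →ₗ[M_μ] H¹_{B,τ'}(A_∞, ℂ)`, `f ↦ f^*α` («by pulling back `α`») and DEFINED `J := pb.liftBaseChange ℂ :
  ℂ ⊗[M_μ] Ω(μ) →ₗ[ℂ] H¹_{B,τ'}(A_∞, ℂ)` = (4.3), with `J_tmul : J (z ⊗ f) = z • f^*α` (Mathlib's factor order `ℂ ⊗[M_μ] Ω(μ)`,
  READING R3 of `Thm418AsPrinted`).
The PREDICATE `Map43AsPrinted M` is the conjunction of what the proof ASSERTS about these objects: (i) «has dimension `1`»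
(l. 2250); (ii) «which is `ℂ[𝔾(𝔸_F^∞)]`-linear» — `f ↦ f^*α` intertwines `D.rhoΩ` and `ρB` (l. 2250); (iii) «(4.3) induces … an
isomorphism … Thus, we obtain an isomorphism as in the theorem» — (4.3) is INJECTIVE (l. 2254–2268).  NOT re-typed: the IMAGE
identification «onto `⊕_{ε,χ} ω(μ, ε, χ)` ⊆ `H¹_{B,τ'}(A_∞, ℂ)`» (it names Prop. 4.13's decomposition; consumers obtain
`block ≤ range J` from multiplicity one, tree `Thm418BlockLeRange`), and the isomorphism of the STATEMENT (that is `Thm418AsPrinted`'s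
main clause — restating it here would re-import the conclusion).  KERNEL CONTENT: `hJ_of_asPrinted` (equivariance of `J` on all of
`ℂ ⊗ Ω(μ)` from (ii)), `J_one_tmul` (the consumer's `hpin` left-hand side `J (1 ⊗ res K D_μ φ) = (res K D_μ φ)^* α` = «`φ^*α`»),
`injective_J_of_asPrinted`, the CERTIFICATE `resW_mem_span_of_fixed_of_asPrinted` (the tree's Δ2 bridge with `J`/`hJ`/`hJinj`
instantiated by name from this record), and a non-vacuity witness of the binder list.  A consumer takes `(h : Map43AsPrinted M)`
for ITS OWN `M`; `∀ M, Map43AsPrinted M` is not claimed (false on degenerate carriers).  NO PROOF of Liu's assertions (Track 2).  HC_CM is NOT proved; this file discharges no COR-CM binder.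

## References
* [Liu2021] Y. Liu, Camb. J. Math. 9 (2021) 1–147 = arXiv:2102.11518 — Lem. 2.4 (1) (l. 1210–1213; in the tree, see above); Def. 4.5 (2)
  (l. 1936–1960); Prop. 4.13 (l. 2113–2119), Thm. 4.15 (l. 2177–2183); Def. 4.16, Rem. 4.17 (l. 2218–2228); Thm. 4.18 (l. 2232–2245) and its
  proof (l. 2247–2270); App. D Prop. D.4, Rem. D.5, Thm. D.6 (the `n = 2` branch of the proof, l. 2263).
* [Fal83] G. Faltings, Endlichkeitssätze für abelsche Varietäten über Zahlkörpern, Invent. Math. 73 (1983) — cited inside the quoted proof only.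
-/

noncomputable section

open scoped TensorProduct
open NumberField TensorProduct

namespace Literature.NumberTheory.Automorphic.Liu2021

namespace Thm418Data

variable {F E : Type} [Field F] [NumberField F] [IsTotallyReal F] [Field E] [NumberField E] [Algebra F E]
  [IsTotallyComplex E] [Algebra.IsQuadraticExtension F E]

/-- **The objects of the proof of [Liu2021, Thm. 4.18], l. 2247–2252, in the proof's order**, over the datum `D` of the theorem:
the object `D_μ`, the embedding `τ' ∈ Φ_μ`, ⟨CARRIER⟩ `H¹_{B,τ'}(A_∞, ℂ)` with its `𝔾(𝔸_F^∞)`-action, ⟨CARRIER⟩ `H¹_{B,τ'}(A_μ, ℂ)`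
with its `M_μ`-action, the chosen basis vector `α` of the `M_μ`-eigenline, and ⟨CARRIER⟩ the pull-back `f ↦ f^*` with its two
functoriality laws.  Nothing is asserted by this structure (module docstring «The typing»).
[cite: Liu2021, proof of Thm. 4.18 (FJcycle.tex l. 2247–2252); Rem. 4.17 (l. 2226–2228); §4.2 l. 2070–2081] -/
structure Map43Data (D : Thm418Data F E) : Type 1 where
  /-- «Take an arbitrary object `D_μ = (A_μ, i_μ, λ_μ, r_μ) ∈ 𝒜(μ)`» (l. 2248). -/
  Dμ : D.Obj
  /-- «Take an embedding `τ' : E → ℂ` …» (l. 2250). -/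
  τ' : E →+* ℂ
  /-- «… in `Φ_μ`» (l. 2250), `Φ_μ = D.cmType` (Def. 4.3 (2)). -/
  τ'_mem : τ' ∈ D.cmType.1
  /-- ⟨CARRIER⟩ the complex vector space `H¹_{B,τ'}(A_∞, ℂ) := colim_K H¹_{B,τ'}(A_K, ℂ)` (§4.2 l. 2079; `A_K = Alb_{X_K}`,
  `X_K = \tilde Sh(𝕍)_K`, l. 2062–2066), the target of «pulling back `α`» (l. 2250–2252). -/
  HB : Type
  [instAddCommGroupHB : AddCommGroup HB]
  [instModuleHB : Module ℂ HB]
  /-- ⟨CARRIER⟩ the action of `𝔾(𝔸_F^∞)` on `H¹_{B,τ'}(A_∞, ℂ)` («an admissible representation of `𝔾(𝔸_F^∞)`», l. 2081), through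
  «the Hecke correspondences … `𝔾(𝔸_F^∞) → Aut_E(A_∞)`» (l. 2074). -/
  ρB : Representation ℂ D.G HB
  /-- ⟨CARRIER⟩ «the complex vector space `H¹_{B,τ'}(A_μ, ℂ)`» (l. 2250), `A_μ` the abelian variety of `D_μ`. -/
  HBμ : Type
  [instAddCommGroupHBμ : AddCommGroup HBμ]
  [instModuleHBμ : Module ℂ HBμ]
  /-- ⟨CARRIER⟩ the `ℂ`-linear action of `M_μ` on `H¹_{B,τ'}(A_μ, ℂ)` («over which `M_μ` acts», l. 2250): induced by the CM structure
  `i_μ : M_μ → End_E(A_μ)_ℚ` of `D_μ` (Def. 4.5 (2), l. 1948) and functoriality of Betti cohomology (`M_μ` is commutative, so the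
  contravariance of `H¹` does not disturb multiplicativity). -/
  iB : fieldOfValues E D.μ →+* Module.End ℂ HBμ
  /-- «We choose a basis `α` of this subspace» (l. 2250): the chosen vector … -/
  α : HBμ
  /-- … lying in «the maximal subspace … over which `M_μ` acts via the inclusion `M_μ ↪ ℂ`» (l. 2250) … -/
  α_mem : ∀ m : fieldOfValues E D.μ, iB m α = algebraMap (fieldOfValues E D.μ) ℂ m • α
  /-- … and non-zero (a basis vector). -/
  α_ne : α ≠ 0
  /-- ⟨CARRIER⟩ `f ↦ f^*`: pull-back of Betti classes `H¹_{B,τ'}(A_μ, ℂ) → H¹_{B,τ'}(A_∞, ℂ)` along `f ∈ Ω(μ) = Hom_E(A_∞, A_μ)_ℚ`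
  («identify `Ω(μ)` with `Hom_E(A_∞, A_μ)_ℚ` by Remark 4.17», l. 2248; «by pulling back», l. 2250). -/
  pull : D.Ω → (HBμ →ₗ[ℂ] HB)
  /-- ⟨CARRIER LAW⟩ additivity of pull-back in the morphism: `(f + f')^* = f^* + f'^*`. -/
  pull_add : ∀ f f' : D.Ω, pull (f + f') = pull f + pull f'
  /-- ⟨CARRIER LAW⟩ «`M_μ` acts via `i_μ`» on `Ω(μ) = Hom_E(A_∞, A_μ)_ℚ` (Def. 4.16, l. 2219) and contravariant functoriality of `H¹`:
  `(i_μ(m) ∘ f)^* = f^* ∘ i_μ(m)^*`. -/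
  pull_smul : ∀ (m : fieldOfValues E D.μ) (f : D.Ω), pull (m • f) = pull f ∘ₗ iB m

attribute [instance] Map43Data.instAddCommGroupHB Map43Data.instModuleHB Map43Data.instAddCommGroupHBμ
  Map43Data.instModuleHBμ

namespace Map43Data

variable {D : Thm418Data F E} (M : D.Map43Data)

/-- **«the maximal subspace of the complex vector space `H¹_{B,τ'}(A_μ, ℂ)` over which `M_μ` acts via the inclusion `M_μ ↪ ℂ`»**
(l. 2250): the simultaneous eigenspace `⋂_{m ∈ M_μ} {x | i_μ(m)^* x = m · x}`, a `ℂ`-subspace — the tree's notion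
`Literature.NumberTheory.Automorphic.PicardCM.eigenline θ σ` («the `σ`-eigenline of an action `θ` of a field on a `ℂ`-vector space»,
`PicardCMPrerequisites.lean`) at `θ := iB`, `σ :=` the inclusion `M_μ ⊆ ℂ`.  An abbreviation; nothing new is defined.
[cite: Liu2021, proof of Thm. 4.18 (l. 2250)] -/
abbrev eigenline : Submodule ℂ M.HBμ :=
  PicardCM.eigenline M.iB (algebraMap (fieldOfValues E D.μ) ℂ)

/-- Unfolding of `eigenline`: `x` lies in it iff `i_μ(m)` acts on `x` by the scalar `m ∈ M_μ ⊆ ℂ` for every `m`.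
[cite: Liu2021, proof of Thm. 4.18 (l. 2250)] -/
theorem mem_eigenline_iff (x : M.HBμ) :
    x ∈ M.eigenline ↔ ∀ m : fieldOfValues E D.μ, M.iB m x = algebraMap (fieldOfValues E D.μ) ℂ m • x := by
  simp only [Map43Data.eigenline, PicardCM.eigenline, Submodule.mem_iInf, Module.End.mem_eigenspace_iff]

/-- The chosen `α` lies in the eigenline (the field `α_mem`, restated as membership). [cite: Liu2021, proof of Thm. 4.18 (l. 2250)] -/
theorem α_mem_eigenline : M.α ∈ M.eigenline :=
  (M.mem_eigenline_iff M.α).2 M.α_mem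

/-- **«we obtain a map `Ω(μ) → H¹_{B,τ'}(A_∞, ℂ)` by pulling back `α`»** (l. 2250): `f ↦ f^*α`.  It is `M_μ`-LINEAR — the content of
«It canonically extends to a map (4.3) `Ω(μ) ⊗_{M_μ} ℂ → …`» (l. 2250–2252) — because `α` is an `M_μ`-eigenvector:
`(m · f)^*α = f^*(i_μ(m)^* α) = f^*(m · α) = m · f^*α` (fields `pull_smul`, `α_mem`).  DEFINED; kernel-checked linearity.
[cite: Liu2021, proof of Thm. 4.18 (l. 2248–2252)] -/
def pb : D.Ω →ₗ[fieldOfValues E D.μ] M.HB where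
  toFun f := M.pull f M.α
  map_add' f f' := by rw [M.pull_add, LinearMap.add_apply]
  map_smul' m f := by
    rw [M.pull_smul, LinearMap.comp_apply, M.α_mem, map_smul, RingHom.id_apply, IntermediateField.smul_def,
      IntermediateField.algebraMap_apply]

/-- `pb f = f^*α` (unfolding). [cite: Liu2021, proof of Thm. 4.18 (l. 2250)] -/
theorem pb_apply (f : D.Ω) : M.pb f = M.pull f M.α :=
  rfl

/-- **THE MAP (4.3)** (TeX label `eq:cm_albanese`, l. 2251–2253): «It canonically extends to a map `Ω(μ) ⊗_{M_μ} ℂ → H¹_{B,τ'}(A_∞, ℂ)`»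
— the `ℂ`-linear extension of `f ↦ f^*α` to the base change (Mathlib's `LinearMap.liftBaseChange`; factor order `ℂ ⊗[M_μ] Ω(μ)` as in
`Thm418AsPrinted`, READING R3).  DEFINED.  This is the `J` of the tree's `Thm418Data.resW_mem_span_of_fixed_of_thm418AsPrinted`.
[cite: Liu2021, proof of Thm. 4.18, (4.3) (l. 2251–2253)] -/
def J : ℂ ⊗[fieldOfValues E D.μ] D.Ω →ₗ[ℂ] M.HB :=
  M.pb.liftBaseChange ℂ

/-- **The literal formula of (4.3) on pure tensors: `z ⊗ f ↦ z · f^*α`** («by pulling back `α`», l. 2250 and l. 2258).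
[cite: Liu2021, proof of Thm. 4.18, (4.3) (l. 2250–2258)] -/
theorem J_tmul (z : ℂ) (f : D.Ω) : M.J (z ⊗ₜ[fieldOfValues E D.μ] f) = z • M.pull f M.α :=
  LinearMap.liftBaseChange_tmul ℂ M.pb z f

/-- `(4.3)` on `1 ⊗ f` is `f^*α` itself. [cite: Liu2021, proof of Thm. 4.18, (4.3) (l. 2250–2252)] -/
theorem J_one_tmul (f : D.Ω) : M.J ((1 : ℂ) ⊗ₜ[fieldOfValues E D.μ] f) = M.pull f M.α := by
  rw [J_tmul, one_smul]

/-- **The consumer's `hpin` left-hand side, unfolded**: for `φ ∈ Hom_E(A_K, A_μ)_ℚ`, `(4.3)` applied to `1 ⊗ (res K D_μ φ)` is the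
pull-back of `α` along the image of `φ` in `Ω(μ) = Hom_E(A_∞, A_μ)_ℚ` — Liu's class «`φ^*α`», whose level-`K` restriction the
consumer identifies with one of its CM classes (via Lem. 2.4 (1) — tree `Motives/AlbaneseRationalCohomology.lean` — and functoriality of `H¹`).
[cite: Liu2021, proof of Thm. 4.18, (4.3) (l. 2248–2252); Thm. 4.18 (1) (l. 2239)] -/
theorem J_one_tmul_res (K : Subgroup D.G) (φ : D.HomK K M.Dμ) :
    M.J ((1 : ℂ) ⊗ₜ[fieldOfValues E D.μ] D.res K M.Dμ φ) = M.pull (D.res K M.Dμ φ) M.α :=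
  M.J_one_tmul _

end Map43Data

end Thm418Data

/-- **[Liu2021, proof of Thm. 4.18 — what it ASSERTS about the map (4.3)], EXACTLY AS PRINTED** (`FJcycle.tex` l. 2247–2268), for
the datum `D` of the theorem and the proof objects `M : D.Map43Data`:

(i)  «It is clear that the maximal subspace of the complex vector space `H¹_{B,τ'}(A_μ, ℂ)` over which `M_μ` acts via the inclusion
     `M_μ ↪ ℂ` has dimension `1`» (l. 2250) — `finrank ℂ eigenline = 1`;
(ii) «we obtain a map `Ω(μ) → H¹_{B,τ'}(A_∞, ℂ)` by pulling back `α`, which is `ℂ[𝔾(𝔸_F^∞)]`-linear» (l. 2250) — `f ↦ f^*α`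
     intertwines the action of `𝔾(𝔸_F^∞)` on `Ω(μ)` (via `A_∞`) with its action on `H¹_{B,τ'}(A_∞, ℂ)` (READING R6 of
     `Thm418AsPrinted`: `ℂ[G]`-linear = linear and `G`-equivariant; the linearity part is `M_μ`-linearity, kernel-checked in `pb`);
(iii) «(4.3) induces … by Faltings' isogeny theorem … we have an isomorphism … induced by pulling back `α` […] Thus, we obtain an
     isomorphism as in the theorem, which depends only on `α`» (l. 2254–2268) — the map (4.3) is INJECTIVE (an isomorphism onto its
     image).  ITS PRINTED JUSTIFICATION IS PROOF-INTERNAL and is named here for the auditors (it is NOT typed): the comparison theorem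
     Betti/étale at `ι_ℓ : ℂ ≅ ℚ_ℓ^{ac}` (l. 2254–2258), Faltings' isogeny theorem [Fal83] (l. 2258–2262), Def. 4.5 (2) (the Galois action on
     `ℚ_ℓ^{ac} · α` is `ι_ℓ ∘ μ^{alg} ∘ (τ')^{-1}`, l. 2263), and, «when `n ≥ 3` (resp. `n = 2`)», Prop. 4.13 (resp. Prop. D.4 (1) with Rem. D.5)
     and Thm. 4.15 = TeX `th:cm_albanese_pre` (resp. Thm. D.6 (1)) (l. 2263–2268).  Over the bare `ℂ`-carriers of this record the clause
     cannot be derived from anything weaker and is ASSUMED as printed; the identification of the image with `⊕_{ε,χ} ω(μ, ε, χ) ⊆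
     H¹_{B,τ'}(A_∞, ℂ)` names Prop. 4.13's decomposition and is not re-typed here, nor is the statement's isomorphism, which is
     `Thm418AsPrinted`'s main clause.  (The sequel `Liu2021/Thm418ProofMapRational.lean` re-types the carriers over RATIONAL Betti
     cohomology and makes (i), (ii), (iii) THEOREMS — (i) by `LinearAlgebra/BaseChange/NumberFieldLineEigenline.lean`, (iii) by
     `Liu2021/Map43Injective.lean` (faithfulness of `H¹` on homomorphisms + linear algebra) — proving `Map43AsPrinted` for the induced
     record; lead gen 8, INBOX l. 5715 (1)(c) / l. 5740 (1).)
No hypothesis is added (in particular no `n ≥ 3`: the proof treats `n ≥ 3` and `n = 2` alike, l. 2263) and none dropped (`τ' ∈ Φ_μ` is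
the field `τ'_mem`).  A consumer takes `(h : Map43AsPrinted M)` for ITS OWN `M`; `∀ M, Map43AsPrinted M` is not the assertion and is
false on degenerate carriers (e.g. `pull := 0` with `Ω(μ) ≠ 0`).  NO PROOF (Track 2).  HC_CM is NOT proved.
[cite: Liu2021, proof of Thm. 4.18 (FJcycle.tex l. 2247–2268)] -/
def Map43AsPrinted {F E : Type} [Field F] [NumberField F] [IsTotallyReal F] [Field E] [NumberField E] [Algebra F E]
    [IsTotallyComplex E] [Algebra.IsQuadraticExtension F E] {D : Thm418Data F E} (M : D.Map43Data) : Prop :=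
  -- (i) l. 2250 «has dimension 1»
  Module.finrank ℂ M.eigenline = 1 ∧
  -- (ii) l. 2250 «which is ℂ[𝔾(𝔸_F^∞)]-linear»
  (∀ (g : D.G) (f : D.Ω), M.pb (D.rhoΩ g f) = M.ρB g (M.pb f)) ∧
  -- (iii) l. 2254–2268 «(4.3) induces … an isomorphism»
  Function.Injective M.J

namespace Thm418Data.Map43Data

variable {F E : Type} [Field F] [NumberField F] [IsTotallyReal F] [Field E] [NumberField E] [Algebra F E]
  [IsTotallyComplex E] [Algebra.IsQuadraticExtension F E] {D : Thm418Data F E} {M : D.Map43Data}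

/-- Dot-notation alias: `M.AsPrinted`. [cite: Liu2021, proof of Thm. 4.18 (l. 2247–2268)] -/
protected abbrev AsPrinted (M : D.Map43Data) : Prop := Liu2021.Map43AsPrinted M

/-- Clause (i): the `M_μ`-eigenline of `H¹_{B,τ'}(A_μ, ℂ)` is one-dimensional. [cite: Liu2021, proof of Thm. 4.18 (l. 2250)] -/
theorem finrank_eigenline_of_asPrinted (h : Map43AsPrinted M) : Module.finrank ℂ M.eigenline = 1 :=
  h.1

/-- Clause (ii) on `Ω(μ)`: `(g · f)^*α = g · (f^*α)`. [cite: Liu2021, proof of Thm. 4.18 (l. 2250)] -/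
theorem pb_rhoΩ_of_asPrinted (h : Map43AsPrinted M) (g : D.G) (f : D.Ω) : M.pb (D.rhoΩ g f) = M.ρB g (M.pb f) :=
  h.2.1 g f

/-- **`hJ` BY NAME — (4.3) is `𝔾(𝔸_F^∞)`-equivariant on all of `Ω(μ) ⊗_{M_μ} ℂ`**: `J ((g ⊗ 1) x) = g · J x`, from clause (ii) on pure
tensors and `ℂ`-linearity (kernel).  Literally the binder `hJ` of `Thm418Data.resW_mem_span_of_fixed_of_thm418AsPrinted` with
`ρH := M.ρB`, `J := M.J`. [cite: Liu2021, proof of Thm. 4.18 (l. 2250–2252)] -/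
theorem hJ_of_asPrinted (h : Map43AsPrinted M) (g : D.G) (x : ℂ ⊗[fieldOfValues E D.μ] D.Ω) :
    M.J ((D.rhoΩ g).baseChange ℂ x) = M.ρB g (M.J x) := by
  induction x using TensorProduct.induction_on with
  | zero => simp only [map_zero]
  | tmul z f =>
    rw [LinearMap.baseChange_tmul, J_tmul, J_tmul, map_smul, ← pb_apply, ← pb_apply, pb_rhoΩ_of_asPrinted h]
  | add x y hx hy => simp only [map_add, hx, hy]

/-- **`hJinj` BY NAME — (4.3) is injective** (clause (iii)).  Literally the binder `hJinj` of
`Thm418Data.resW_mem_span_of_fixed_of_thm418AsPrinted` with `J := M.J`. [cite: Liu2021, proof of Thm. 4.18 (l. 2254–2268)] -/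
theorem injective_J_of_asPrinted (h : Map43AsPrinted M) : Function.Injective M.J :=
  h.2.2

/-- The equivariance for an arbitrary action presentation `act` of the consumer agreeing with `ρB` (the `_act` variants of the tree's
bridge take `act g x := MonoidAlgebra.of ℂ 𝔾 g • x`). [cite: Liu2021, proof of Thm. 4.18 (l. 2250–2252)] -/
theorem hJ_act_of_asPrinted (h : Map43AsPrinted M) (act : D.G → M.HB → M.HB) (hact : ∀ g x, act g x = M.ρB g x) (g : D.G)
    (x : ℂ ⊗[fieldOfValues E D.μ] D.Ω) : M.J ((D.rhoΩ g).baseChange ℂ x) = act g (M.J x) := by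
  rw [hact, hJ_of_asPrinted h]

/-- **CERTIFICATE — the Δ2 bridge consumed BY NAME.**  The tree's `Thm418Data.resW_mem_span_of_fixed_of_thm418AsPrinted`
(`Thm418CombinedReading.lean`: [Liu2021] Thm. 4.18 (1) AS PRINTED ⟹ the `hmap` clause of the package's combined reading r8) with its
three consumer-side binders `J` / `hJ` / `hJinj` INSTANTIATED by this file's (4.3): `J := M.J`, `hJ := hJ_of_asPrinted h43`,
`hJinj := injective_J_of_asPrinted h43`, `D_μ := M.Dμ`, `H := H¹_{B,τ'}(A_∞, ℂ) = M.HB` with `ρH := M.ρB`.  What remains the consumer's: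
the level system (`Kof`, monotone, open compact, cofinal), the geometric side `resW K` with its CM classes `cmCl K`, and the class
identification `hpin`, now stated on Liu's class itself — «the level-`K` restriction of `φ^*α` is a CM class» (`M.pull (res K D_μ φ) α`;
Lem. 2.4 (1) + functoriality on the consumer's side).  Cite class of the conclusion: {[Liu2021] Thm. 4.18 as printed, [Liu2021] proof of
Thm. 4.18 ((4.3)) as printed}.  HC_CM is NOT proved; no COR-CM binder is discharged here.
[cite: Liu2021, Thm. 4.18 (1) (l. 2239) with its proof, (4.3) (l. 2247–2268)] -/
theorem resW_mem_span_of_fixed_of_asPrinted (h418 : Liu2021.Thm418AsPrinted D) (h43 : Map43AsPrinted M)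
    {Lvl : Type*} [Preorder Lvl] (Kof : Lvl → Subgroup D.G)
    (hmono : ∀ ⦃K K' : Lvl⦄, K ≤ K' → Kof K ≤ Kof K') (hoc : ∀ K : Lvl, IsOpenCompact (Kof K))
    (hcof : ∀ K' : Subgroup D.G, IsOpenCompact K' → ∃ K₀ : Lvl, Kof K₀ ≤ K')
    {W : Lvl → Type*} [∀ K, AddCommGroup (W K)] [∀ K, Module ℂ (W K)]
    (resW : ∀ K : Lvl, M.HB →ₗ[ℂ] W K) (cmCl : ∀ K : Lvl, Set (W K))
    (hpin : ∀ (K : Lvl) (φ : D.HomK (Kof K) M.Dμ), resW K (M.pull (D.res (Kof K) M.Dμ φ) M.α) ∈ cmCl K) :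
    ∃ K₀ : Lvl, ∀ K ≤ K₀, ∀ x : ℂ ⊗[fieldOfValues E D.μ] D.Ω,
      (∀ k ∈ Kof K, M.ρB k (M.J x) = M.J x) → resW K (M.J x) ∈ Submodule.span ℂ (cmCl K) :=
  resW_mem_span_of_fixed_of_thm418AsPrinted h418 M.Dμ Kof hmono hoc hcof M.ρB resW cmCl M.J (fun g x => hJ_of_asPrinted h43 g x)
    (injective_J_of_asPrinted h43) fun K φ => by rw [J_one_tmul_res]; exact hpin K φ

end Thm418Data.Map43Data

/-- **The binder list `Map43Data` + `Map43AsPrinted` is jointly satisfiable** (hypothesis non-vacuity — bookkeeping, says nothing about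
Liu's objects): over every CM extension `E/F` as in l. 1878 there are a datum `D` (a REAL weight-one conjugate symplectic `μ`, tree
`IdeleClassGroup.exists_isConjugateSymplectic_hasCMType`; trivial carriers, `Ω(μ) := 0`) and proof objects `M` (`H¹ := ℂ` with `M_μ`
acting by scalars, `α := 1`, `pull := 0`, `τ'` any element of `Φ_μ` — a CM type is non-empty) satisfying (i)–(iii).
[cite: Liu2021, proof of Thm. 4.18 (l. 2247–2268)] -/
theorem exists_map43AsPrinted (F E : Type) [Field F] [NumberField F] [IsTotallyReal F] [Field E] [NumberField E] [Algebra F E]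
    [IsTotallyComplex E] [Algebra.IsQuadraticExtension F E] :
    ∃ (D : Thm418Data F E) (M : D.Map43Data), Map43AsPrinted M := by
  classical
  letI : IsCMField E := isCMField F E
  obtain ⟨μ, hμ, hw, -⟩ := IdeleClassGroup.exists_isConjugateSymplectic_hasCMType (L := E)
    (IdeleClassGroup.cmTypeOf E (fun _ => -1) (by simp))
  -- an embedding in `Φ_μ`: a CM type contains one of each conjugate pair of embeddings
  obtain ⟨τ', hτ'⟩ : ∃ τ' : E →+* ℂ, τ' ∈ hμ.cmType.1 := by
    let φ : E →+* ℂ := Classical.arbitrary (E →+* ℂ)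
    by_cases hφ : φ ∈ hμ.cmType.1
    · exact ⟨φ, hφ⟩
    · exact ⟨ComplexEmbedding.conjugate φ, Classical.not_not.1 fun h => hφ ((hμ.cmType.2 φ).2 h)⟩
  let D : Thm418Data F E := ⟨2, le_rfl, PUnit, PUnit, PUnit, fun _ => PUnit.unit, PUnit, μ, hμ, hw, PUnit, fun _ _ => PUnit,
    fun _ _ => 1, PUnit, 1, fun _ _ => PUnit, fun _ _ => 0⟩
  -- `M_μ` acting on `ℂ` by scalars
  let iB : fieldOfValues E μ →+* Module.End ℂ ℂ :=
    (algebraMap ℂ (Module.End ℂ ℂ)).comp (algebraMap (fieldOfValues E μ) ℂ)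
  have hiB : ∀ (m : fieldOfValues E μ) (z : ℂ), iB m z = algebraMap (fieldOfValues E μ) ℂ m • z := fun m z => by
    simp only [iB, RingHom.coe_comp, Function.comp_apply, Module.algebraMap_end_apply]
  let M : D.Map43Data :=
    { Dμ := PUnit.unit, τ' := τ', τ'_mem := hτ', HB := ℂ, ρB := 1, HBμ := ℂ, iB := iB, α := 1,
      α_mem := fun m => hiB m 1, α_ne := one_ne_zero, pull := fun _ => 0,
      pull_add := fun _ _ => (add_zero _).symm, pull_smul := fun _ _ => (LinearMap.zero_comp _).symm }
  -- `Ω(μ) := 0`, so `ℂ ⊗ Ω(μ) = 0` and (4.3) is injective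
  have hΩ : ∀ w : ℂ ⊗[fieldOfValues E μ] D.Ω, w = 0 := fun w =>
    w.induction_on rfl (fun z p => by rw [Subsingleton.elim p 0, tmul_zero]) fun a b ha hb => by rw [ha, hb, add_zero]
  refine ⟨D, M, ?_, fun g f => rfl, fun x y _ => by rw [hΩ x, hΩ y]⟩
  -- (i): the eigenline is all of `ℂ`
  have htop : M.eigenline = ⊤ := eq_top_iff.2 fun x _ => (M.mem_eigenline_iff x).2 fun m => hiB m x
  rw [htop, finrank_top, Module.finrank_self]

end Literature.NumberTheory.Automorphic.Liu2021

end
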